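import Literature.NumberTheory.EllipticCurves.IsogenyOfLeafRelationProofs
import Literature.NumberTheory.EllipticCurves.LocalParamPoleClearingProofs
import Literature.NumberTheory.EllipticCurves.FormalLeafDenominatorBoundProofs
import Literature.NumberTheory.EllipticCurves.ComplexPeriodProofs
import Literature.NumberTheory.EllipticCurves.IsogenyFrobeniusTraceProofs
import HarnessLib

/-!
# Faltings' isogeny theorem over `ℚ` from André's algebraicity criterion (Bost 2001, Cor. 2.5):
# the assembly (proofs only)

Topic `Literature/NumberTheory/EllipticCurves`; a proofs-only file (theorems only). It assembles
Bost's Faltings-free proof of the named fact `WeierstrassCurve.isIsogenous_iff_frobeniusTrace_eq`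
(`Isogeny.lean`; Faltings 1983, §5 Kor. 2 for elliptic curves over `ℚ` = Bost 2001, Cor. 2.5)
from the pieces in the tree, **conditionally on André's algebraicity criterion over `ℚ`** in the
precise form spelled out below as the explicit hypothesis `crit` (Chambert-Loir,
Sém. Bourbaki 886, Thm. 6.2 (first part) for `K = ℚ`: a series `y ∈ ℚ⟦x⟧` whose rows
`([xᵐ] xᵃyᵇ)` have integer denominators `Den m ≤ Cᵐ` and which is uniformised, together with `x`,
by meromorphic functions on a disc of radius `R > C` — `(φ, ψ) = (F/g, G/g)`, `φ(0) = 0`,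
`φ'(0) = 1`, `y(φ̂) = ψ̂` — satisfies a non-trivial polynomial relation `Σ c_{ab} xᵃ yᵇ = 0`).
The tree has the two halves of the criterion's proof (`Transcendental/AndreCriterionLinearAlgebra
Proofs`, `…AnalyticProofs`); the criterion itself, in exactly this form, is
`Literature.NumberTheory.Transcendental.AndreCriterion.exists_relation_of_den_of_uniformization`
(`Transcendental/AndreCriterionRationalProofs`), and the named fact is then discharged by
`isIsogenous_iff_frobeniusTrace_eq_of_andreCriterion` applied to it (sibling file
`IsogenyFrobeniusTraceHoldsProofs`). Nothing is asserted here
beyond that implication; no named fact is introduced (D-0026).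

The unconditional inputs (all in the tree):
* `⇒`: `finite_setOf_frobeniusTrace_ne_of_isIsogenous` (`IsogenyFrobeniusTraceProofs`);
* Néron period pairs: `exists_periodPair_of_isElliptic'` (`ComplexPeriodProofs`, from the
  Uniformisation Theorem `PeriodPair.uniformization_holds`);
* denominators (`p`-adic input, Bost Prop. 3.9): `exists_den_leaf_of_finite`
  (`FormalLeafDenominatorBoundProofs`; Hasse invariant, Hochschild's formula, `ξᵖ = 0`);
* the formal leaf is the analytic leaf: `analyticAt_localParam`, `deriv_localParam_zero`
  (`FormalExpTaylorUniformizationProofs`), `map_leaf_subst_taylor_localParam`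
  (`FormalLogExpBaseChangeProofs`);
* pole clearing on any disc: `exists_pole_clearing_pair` (`LocalParamPoleClearingProofs`);
* from a relation to the isogeny: `isIsogenous_of_sum_C_mul_X_pow_mul_leaf_pow_eq_zero`
  (`IsogenyOfLeafRelationProofs`, using `isIsogenous_of_evalEval_comp_eq_zero`).

## References

* J.-B. Bost, *Algebraic leaves of algebraic foliations over number fields*, Publ. Math. IHÉS 93
  (2001), Thm. 2.1, Thm. 2.3, Cor. 2.5, Prop. 3.9. [Bost2001AlgebraicLeaves]
* A. Chambert-Loir, *Théorèmes d'algébricité en géométrie diophantienne*, Sém. Bourbaki 886,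
  Astérisque 282 (2002), Thm. 6.2 and §6. [ChambertLoir2002Bourbaki]
* G. Faltings, Invent. Math. 73 (1983), §5 Korollar 2. [Faltings1983Endlichkeit]
-/

noncomputable section

open PowerSeries Filter Set Metric
open scoped Topology Nat Classical PeriodPair

/-- The Taylor series of `f : ℂ → ℂ` at `0` (local notation, as in
`AndreCriterionAnalyticProofs`). -/
local notation3 "𝓣[" f "]" =>
  (PowerSeries.mk fun n => ((Nat.factorial n : ℂ)⁻¹ * iteratedDeriv n f 0) : PowerSeries ℂ)

namespace WeierstrassCurve

open Literature.NumberTheory.EllipticCurves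

/-- **The isogeny theorem for a pair of elliptic curves over `ℚ` from André's criterion.** Assume
André's algebraicity criterion over `ℚ` in the following form (Chambert-Loir, Sém. Bourbaki 886,
Thm. 6.2, `K = ℚ`, with `τ(y) ≤ log C` encoded by integer row denominators `Den m ≤ Cᵐ`): for
`y ∈ ℚ⟦x⟧` with `Den n · [xᵐ](yʲ) ∈ ℤ` (`m ≤ n`), `0 < Den n ≤ Cⁿ`, and `g, F, G` holomorphic on
`|z| < R`, `R > C`, with `F = gφ`, `G = gψ` near `0`, `g(0) = 1`, `φ(0) = 0`, `φ'(0) = 1`,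
`y(φ̂) = ψ̂`, there is a non-trivial relation `Σ_{a ≤ d, b ≤ D} c_{ab} xᵃ yᵇ = 0`. Then two globally
minimal elliptic curves over `ℚ` whose traces of Frobenius agree at all but finitely many primes
are isogenous over `ℚ` (Bost 2001, Cor. 2.5, 2) ⇒ 1)). [cite: Bost2001AlgebraicLeaves, Cor. 2.5] -/
theorem isIsogenous_of_finite_frobeniusTrace_ne_of_andreCriterion
    (crit : ∀ (y : PowerSeries ℚ) (Den : ℕ → ℕ) (C : ℝ), 0 < C → (∀ n, 0 < Den n) →
      (∀ n, (Den n : ℝ) ≤ C ^ n) → (∀ n m j, m ≤ n → ∃ z : ℤ, (Den n : ℚ) * coeff m (y ^ j) = z) →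
      ∀ (R : ℝ), C < R → ∀ (g F G φf ψf : ℂ → ℂ), DifferentiableOn ℂ g (ball 0 R) →
      DifferentiableOn ℂ F (ball 0 R) → DifferentiableOn ℂ G (ball 0 R) →
      AnalyticAt ℂ φf 0 → AnalyticAt ℂ ψf 0 → F =ᶠ[𝓝 0] g * φf → G =ᶠ[𝓝 0] g * ψf → g 0 = 1 →
      φf 0 = 0 → deriv φf 0 = 1 →
      PowerSeries.subst 𝓣[φf] (PowerSeries.map (algebraMap ℚ ℂ) y) = 𝓣[ψf] →
      ∃ (d D : ℕ) (c : Fin (d + 1) × Fin (D + 1) → ℚ), c ≠ 0 ∧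
        ∑ ab, PowerSeries.C (c ab) * (X ^ (ab.1 : ℕ) * y ^ (ab.2 : ℕ)) = 0)
    (W W' : WeierstrassCurve ℚ) [W.IsElliptic] [W'.IsElliptic] [W.IsGloballyMinimal]
    [W'.IsGloballyMinimal] (hfin : {p : ℕ | p.Prime ∧ W.frobeniusTrace p ≠ W'.frobeniusTrace p}.Finite) :
    IsIsogenous W W' := by
  -- Néron period pairs for the two curves over `ℂ`
  haveI : (W.baseChange ℂ).IsElliptic := ⟨by
    rw [baseChange, map_Δ]; exact W.isUnit_Δ.map _⟩
  haveI : (W'.baseChange ℂ).IsElliptic := ⟨by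
    rw [baseChange, map_Δ]; exact W'.isUnit_Δ.map _⟩
  obtain ⟨L₁, h₁₂, h₁₃⟩ := (W.baseChange ℂ).exists_periodPair_of_isElliptic'
  obtain ⟨L₂, h₂₂, h₂₃⟩ := (W'.baseChange ℂ).exists_periodPair_of_isElliptic'
  -- the denominators of the rational leaf `y = exp_{W'}(log_W x)`
  obtain ⟨Den, C, hDen, hC, hZ⟩ := exists_den_leaf_of_finite W W' hfin
  have hCpos : 0 < C := by
    have h1 := hC 1
    rw [pow_one] at h1
    have : (1 : ℝ) ≤ Den 1 := by exact_mod_cast hDen 1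
    linarith
  -- pole clearing on the disc of radius `C + 1`
  obtain ⟨g, F, G, hg, hF, hG, hg0, hFg, hGg⟩ :=
    exists_pole_clearing_pair L₁ L₂ (W.baseChange ℂ) (W'.baseChange ℂ) (R := C + 1) (by linarith)
  -- the criterion
  obtain ⟨d, D, c, hc, hS⟩ := crit (W'.formalExp.subst W.formalLog) Den C hCpos hDen hC hZ (C + 1)
    (by linarith) g F G _ _ hg.differentiableOn hF.differentiableOn hG.differentiableOn
    (analyticAt_localParam L₁ (W.baseChange ℂ)).1 (analyticAt_localParam L₂ (W'.baseChange ℂ)).1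
    hFg hGg hg0 (if_pos (zero_mem _)) (deriv_localParam_zero L₁ (W.baseChange ℂ))
    (map_leaf_subst_taylor_localParam W W' L₁ L₂ h₁₂ h₁₃ h₂₂ h₂₃)
  -- pass to complex coefficients and conclude
  refine isIsogenous_of_sum_C_mul_X_pow_mul_leaf_pow_eq_zero W W' h₁₂ h₁₃ h₂₂ h₂₃
    (fun ab => (c ab : ℂ)) ?_ ?_
  · intro h
    apply hc
    funext ab
    have := congrFun h ab
    simpa using this
  · have h := congrArg (PowerSeries.map (algebraMap ℚ ℂ)) hS
    rw [map_sum, map_zero] at h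
    refine (Finset.sum_congr rfl fun ab _ => ?_).symm.trans h
    rw [map_mul, map_mul, map_pow, map_pow, PowerSeries.map_C, PowerSeries.map_X, eq_ratCast]

/-- **Faltings' isogeny theorem over `ℚ` (the tree's named fact) from André's criterion**: given
the criterion in the form above, `isIsogenous_iff_frobeniusTrace_eq` holds — "⇒" is the tree's
`finite_setOf_frobeniusTrace_ne_of_isIsogenous` (Silverman AEC, Ex. 5.4), "⇐" is
`isIsogenous_of_finite_frobeniusTrace_ne_of_andreCriterion` (Bost 2001, Cor. 2.5).
[cite: Bost2001AlgebraicLeaves, Cor. 2.5] -/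
theorem isIsogenous_iff_frobeniusTrace_eq_of_andreCriterion
    (crit : ∀ (y : PowerSeries ℚ) (Den : ℕ → ℕ) (C : ℝ), 0 < C → (∀ n, 0 < Den n) →
      (∀ n, (Den n : ℝ) ≤ C ^ n) → (∀ n m j, m ≤ n → ∃ z : ℤ, (Den n : ℚ) * coeff m (y ^ j) = z) →
      ∀ (R : ℝ), C < R → ∀ (g F G φf ψf : ℂ → ℂ), DifferentiableOn ℂ g (ball 0 R) →
      DifferentiableOn ℂ F (ball 0 R) → DifferentiableOn ℂ G (ball 0 R) →
      AnalyticAt ℂ φf 0 → AnalyticAt ℂ ψf 0 → F =ᶠ[𝓝 0] g * φf → G =ᶠ[𝓝 0] g * ψf → g 0 = 1 →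
      φf 0 = 0 → deriv φf 0 = 1 →
      PowerSeries.subst 𝓣[φf] (PowerSeries.map (algebraMap ℚ ℂ) y) = 𝓣[ψf] →
      ∃ (d D : ℕ) (c : Fin (d + 1) × Fin (D + 1) → ℚ), c ≠ 0 ∧
        ∑ ab, PowerSeries.C (c ab) * (X ^ (ab.1 : ℕ) * y ^ (ab.2 : ℕ)) = 0) :
    isIsogenous_iff_frobeniusTrace_eq := by
  intro W W' _ _ _ _
  exact ⟨fun h => finite_setOf_frobeniusTrace_ne_of_isIsogenous h,
    fun h => isIsogenous_of_finite_frobeniusTrace_ne_of_andreCriterion crit W W' h⟩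

end WeierstrassCurve

end
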